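import Summits.KontsevichZagierPeriods.KontsevichZagierPeriods.Theorems.SoloBlindLine
import HarnessLib

/-!
# The Kontsevich–Zagier conjecture in dimension `≤ 1`, Ib: moves on the line, the constant cell

Continuation of `SoloBlindLine`: the three Kontsevich–Zagier rules specialised to one-variable
representations `[S, f]` — splitting an interval (additivity of the domain), linear and general
semialgebraic `C¹` substitutions (change of variables), the Newton–Leibniz move
`[[a, b], ρ'] ≡ [pt, ρ b − ρ a]` — and the constant cell `K(α) = [pt, α]` with its algebra;
every rational dimension-`0` representation is congruent to a rational constant cell.

Reference: M. Kontsevich, D. Zagier, *Periods* (2001), §1.2 (the three rules).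
-/

noncomputable section

open MeasureTheory Set Filter
open scoped BigOperators Topology

namespace Summit.KontsevichZagierPeriods.KontsevichZagierPeriods.Theorems

open Literature.NumberTheory.Transcendental
open Literature.NumberTheory.Transcendental.KZ
open Literature.ModelTheory.ExponentialFields (IsSemialgebraic isSemialgebraic_univ)

namespace SoloBlind

/-! ### Moves on one-variable representations -/

section moves

/-- Splitting an interval at an interior point is domain additivity. -/
theorem lineRep_split {a l b : ℝ} (hal : a ≤ l) (hlb : l ≤ b) (f : ℝ → ℝ)
    {hS : IsSemialgebraic ℚ (line (Icc a b))}
    {hf : IsSemialgebraicFunOn ℚ (line (Icc a b)) (fun x => f (x 0))}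
    {hi : IntegrableOn f (Icc a b)}
    {hS₁ : IsSemialgebraic ℚ (line (Icc a l))}
    {hf₁ : IsSemialgebraicFunOn ℚ (line (Icc a l)) (fun x => f (x 0))}
    {hi₁ : IntegrableOn f (Icc a l)}
    {hS₂ : IsSemialgebraic ℚ (line (Icc l b))}
    {hf₂ : IsSemialgebraicFunOn ℚ (line (Icc l b)) (fun x => f (x 0))}
    {hi₂ : IntegrableOn f (Icc l b)} :
    of (lineRep (Icc a b) f hS hf hi) - of (lineRep (Icc a l) f hS₁ hf₁ hi₁) -
      of (lineRep (Icc l b) f hS₂ hf₂ hi₂) ∈ relations := by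
  refine domainAddRel_subset_relations ⟨1, lineRep (Icc a b) f hS hf hi,
    lineRep (Icc a l) f hS₁ hf₁ hi₁, lineRep (Icc l b) f hS₂ hf₂ hi₂, ?_, ?_, fun _ _ => rfl,
    fun _ _ => rfl, rfl⟩
  · simp only [lineRep_domain, ← line_union, Icc_union_Icc_eq_Icc hal hlb]
  · simp only [lineRep_domain, ← line_inter, volume_line]
    exact measure_mono_null (fun x hx => le_antisymm hx.1.2 hx.2.1) Real.volume_singleton

/-- A linear substitution `t = s u` (`s ≠ 0` real algebraic) is a change of variables:
`[S, f] ≡ [s S, g]` when `f t = g (s t) |s|` on `S`. -/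
theorem lineRep_dilate {s : ℝ} (hs : IsAlgebraic ℚ s) (hs0 : s ≠ 0) {S S' : Set ℝ}
    {f g : ℝ → ℝ} (hS' : S' = (fun t => s * t) '' S) (hfg : ∀ t ∈ S, f t = g (s * t) * |s|)
    {hS : IsSemialgebraic ℚ (line S)} {hf : IsSemialgebraicFunOn ℚ (line S) (fun x => f (x 0))}
    {hi : IntegrableOn f S} {hS₁ : IsSemialgebraic ℚ (line S')}
    {hg : IsSemialgebraicFunOn ℚ (line S') (fun x => g (x 0))} {hi₁ : IntegrableOn g S'} :
    of (lineRep S f hS hf hi) - of (lineRep S' g hS₁ hg hi₁) ∈ relations := by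
  refine smul_sub_mem_relations hs hs0 _ _ ?_ ?_
  · ext x
    simp only [lineRep_domain, mem_line, hS', mem_image]
    constructor
    · rintro ⟨t, ht, hx⟩
      refine ⟨fun _ => t, ht, ?_⟩
      rw [eq_const_apply_zero x]
      funext i
      simp [hx]
    · rintro ⟨u, hu, rfl⟩
      exact ⟨u 0, hu, by simp⟩
  · intro x hx
    simp only [lineRep_integrand, Pi.smul_apply, smul_eq_mul, pow_one]
    exact hfg _ hx

/-- A semialgebraic `C¹` substitution `t = φ u` on the line is a change of variables:
`[S, f] ≡ [φ S, g]` when `f = (g ∘ φ) |φ'|` on `S`. -/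
theorem lineRep_subst {S T : Set ℝ} {f g : ℝ → ℝ} (φ φ' : ℝ → ℝ)
    (hφ : IsSemialgebraicFunOn ℚ (line S) (fun x => φ (x 0)))
    (hder : ∀ t ∈ S, HasDerivWithinAt φ (φ' t) S t) (hinj : InjOn φ S) (hT : T = φ '' S)
    (hfg : ∀ t ∈ S, f t = g (φ t) * |φ' t|)
    {hS : IsSemialgebraic ℚ (line S)} {hf : IsSemialgebraicFunOn ℚ (line S) (fun x => f (x 0))}
    {hi : IntegrableOn f S} {hS₁ : IsSemialgebraic ℚ (line T)}
    {hg : IsSemialgebraicFunOn ℚ (line T) (fun x => g (x 0))} {hi₁ : IntegrableOn g T} :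
    of (lineRep S f hS hf hi) - of (lineRep T g hS₁ hg hi₁) ∈ relations := by
  set Φ : (Fin 1 → ℝ) → (Fin 1 → ℝ) := fun u _ => φ (u 0) with hΦ
  set Φ' : (Fin 1 → ℝ) → (Fin 1 → ℝ) →L[ℝ] (Fin 1 → ℝ) :=
    fun u => (φ' (u 0)) • ContinuousLinearMap.id ℝ (Fin 1 → ℝ) with hΦ'
  have hmap : IsSemialgebraicMapOn ℚ (line S) Φ := IsSemialgebraicMapOn.of_forall hS fun _ => hφ
  have hder' : ∀ x ∈ line S, HasFDerivWithinAt Φ (Φ' x) (line S) x := by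
    intro x hx
    rw [hasFDerivWithinAt_pi']
    intro i
    obtain rfl : i = 0 := Subsingleton.elim _ _
    have h1 : HasFDerivWithinAt (𝕜 := ℝ) (fun u : Fin 1 → ℝ => u 0)
        (ContinuousLinearMap.proj (R := ℝ) (φ := fun _ : Fin 1 => ℝ) 0) (line S) x :=
      hasFDerivWithinAt_apply 0 x _
    have h2 := (hder _ hx).hasFDerivWithinAt.comp x h1 fun u hu => hu
    have h3 : (ContinuousLinearMap.proj (R := ℝ) (φ := fun _ : Fin 1 => ℝ) 0).comp (Φ' x) =
        (ContinuousLinearMap.smulRight (1 : ℝ →L[ℝ] ℝ) (φ' (x 0))).comp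
          (ContinuousLinearMap.proj (R := ℝ) (φ := fun _ : Fin 1 => ℝ) 0) :=
      ContinuousLinearMap.ext fun v => by simp [hΦ', mul_comm]
    rw [h3]
    exact h2
  have hinj' : InjOn Φ (line S) := by
    intro u hu v hv huv
    have h : φ (u 0) = φ (v 0) := congr_fun huv 0
    rw [eq_const_apply_zero u, eq_const_apply_zero v, hinj hu hv h]
  have hdom : (lineRep T g hS₁ hg hi₁).domain = Φ '' (lineRep S f hS hf hi).domain := by
    ext x
    simp only [lineRep_domain, mem_line, hT, mem_image]
    constructor
    · rintro ⟨t, ht, hx⟩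
      refine ⟨fun _ => t, ht, ?_⟩
      rw [eq_const_apply_zero x]
      funext
      simp [hΦ, hx]
    · rintro ⟨u, hu, rfl⟩
      exact ⟨u 0, hu, rfl⟩
  have hint : ∀ x ∈ (lineRep S f hS hf hi).domain, (lineRep S f hS hf hi).integrand x =
      (lineRep T g hS₁ hg hi₁).integrand (Φ x) * |(Φ' x).det| := by
    intro x hx
    simp only [lineRep_integrand, hΦ, hΦ']
    rw [hfg _ hx, det_smul_id_fin, pow_one]
  exact changeOfVariablesRel_subset_relations ⟨1, lineRep S f hS hf hi, lineRep T g hS₁ hg hi₁,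
    Φ, Φ', hmap, hder', hinj', hdom, hint, rfl⟩

end moves

/-! ## The constant cell `K(α) = [pt, α]` -/

/-- The constant cell `[pt, α]` (dimension `0`), `α` real algebraic. -/
def constCell (α : ℝ) (hα : IsAlgebraic ℚ α) : IntegralRep 0 where
  domain := univ
  integrand _ := α
  isSemialgebraic_domain := isSemialgebraic_univ
  isSemialgebraicFunOn_integrand := isSemialgebraicFunOn_const_of_isAlgebraic isSemialgebraic_univ hα
  integrableOn := integrableOn_const (hs := by simp [volume_univ_fin_zero])

/-- The domain of `[pt, α]` is the point. -/
@[simp] theorem constCell_domain {α : ℝ} {hα : IsAlgebraic ℚ α} :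
    (constCell α hα).domain = univ := rfl

/-- The integrand of `[pt, α]` is the constant `α`. -/
@[simp] theorem constCell_integrand {α : ℝ} {hα : IsAlgebraic ℚ α} :
    (constCell α hα).integrand = fun _ => α := rfl

/-- `value [pt, α] = α`. -/
@[simp] theorem value_constCell {α : ℝ} {hα : IsAlgebraic ℚ α} : (constCell α hα).value = α := by
  simp [IntegralRep.value, Measure.restrict_univ, measureReal_def, volume_univ_fin_zero]

/-- `K(α + β) ≡ K(α) + K(β)`. -/
theorem constCell_add {α β : ℝ} {hα : IsAlgebraic ℚ α} {hβ : IsAlgebraic ℚ β}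
    {hαβ : IsAlgebraic ℚ (α + β)} :
    of (constCell (α + β) hαβ) - of (constCell α hα) - of (constCell β hβ) ∈ relations :=
  of_sub_sub_mem_relations_of_add rfl rfl fun _ _ => rfl

/-- `K(0) ≡ 0`. -/
theorem constCell_zero {h0 : IsAlgebraic ℚ (0:ℝ)} : of (constCell 0 h0) ∈ relations :=
  of_mem_relations_of_eqOn_zero _ fun _ _ => rfl

/-- `K(α) + K(−α) ≡ 0`. -/
theorem constCell_neg {α : ℝ} {hα : IsAlgebraic ℚ α} {hα' : IsAlgebraic ℚ (-α)} :
    of (constCell α hα) + of (constCell (-α) hα') ∈ relations :=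
  of_add_of_mem_relations_of_neg rfl fun _ _ => rfl

/-- `K(k α) ≡ k • K(α)` for `k ∈ ℤ`. -/
theorem constCell_zsmul (k : ℤ) {α : ℝ} {hα : IsAlgebraic ℚ α} {hkα : IsAlgebraic ℚ (k * α)} :
    of (constCell (k * α) hkα) - k • of (constCell α hα) ∈ relations :=
  of_sub_zsmul_mem_relations k rfl fun _ _ => rfl

/-- Two constant cells with the same value are the same representation. -/
theorem constCell_congr {α β : ℝ} (h : α = β) {hα : IsAlgebraic ℚ α} {hβ : IsAlgebraic ℚ β} :
    constCell α hα = constCell β hβ := by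
  subst h; rfl

/-- A rational dimension-`0` representation is congruent to a rational constant cell with the
same value. -/
theorem exists_constCell_of_dim_zero (r : IntegralRep 0) (hr : r.IsRational) :
    ∃ (q : ℚ), of r - of (constCell (q : ℝ) (isAlgebraic_algebraMap q)) ∈ relations ∧
      r.value = q := by
  classical
  by_cases hdom : r.domain = ∅
  · refine ⟨0, ?_, ?_⟩
    · have h1 : of r ∈ relations := of_mem_relations_of_volume_eq_zero r (by simp [hdom])
      have h2 : of (constCell ((0:ℚ) : ℝ) (isAlgebraic_algebraMap (0:ℚ))) ∈ relations :=
        of_mem_relations_of_eqOn_zero _ fun _ _ => by simp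
      exact relations.sub_mem h1 h2
    · simp [IntegralRep.value, hdom]
  · have huniv : r.domain = univ := by
      obtain ⟨x, hx⟩ := nonempty_iff_ne_empty.mpr hdom
      exact eq_univ_of_forall fun y => by rwa [Subsingleton.elim y x]
    obtain ⟨p, q, hq, hpq⟩ := hr
    set x₀ : Fin 0 → ℝ := Fin.elim0 with hx₀
    have hx₀mem : x₀ ∈ r.domain := by simp [huniv]
    -- the value of the integrand at the point is the rational number `p(pt)/q(pt)`
    have hconst : ∀ (P : MvPolynomial (Fin 0) ℚ),
        MvPolynomial.aeval x₀ P = ((P.coeff 0 : ℚ) : ℝ) := by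
      intro P
      conv_lhs => rw [MvPolynomial.eq_C_of_isEmpty P]
      simp
    set c : ℚ := p.coeff 0 / q.coeff 0 with hc
    have hval : ∀ x ∈ r.domain, r.integrand x = (c : ℝ) := by
      intro x hx
      obtain rfl : x = x₀ := Subsingleton.elim _ _
      have h := hpq hx
      simp only at h
      rw [h, hconst p, hconst q, hc, Rat.cast_div]
    refine ⟨c, ?_, ?_⟩
    · exact of_sub_of_mem_relations_of_eqOn (by simp [huniv]) fun x hx => by
        simpa using hval x hx
    · rw [IntegralRep.value, huniv, Measure.restrict_univ,
        show r.integrand = fun _ => (c : ℝ) from funext fun x => hval x (by simp [huniv])]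
      simp [measureReal_def, volume_univ_fin_zero]

/-! ## Newton–Leibniz on the line -/

/-- **Newton–Leibniz move on the line.** If `ρ` is `ℚ`-semialgebraic and continuous on `[a, b]`
with derivative `f` on `(a, b)`, then `[[a, b], f] ≡ [pt, ρ b − ρ a]`. -/
theorem lineRep_newtonLeibniz {a b : ℝ} (ha : IsAlgebraic ℚ a) (hb : IsAlgebraic ℚ b)
    (hab : a ≤ b) {f : ℝ → ℝ} (ρ : ℝ → ℝ)
    (hρ : IsSemialgebraicFunOn ℚ (line (Icc a b)) (fun x => ρ (x 0)))
    (hcont : ContinuousOn ρ (Icc a b)) (hder : ∀ t ∈ Ioo a b, HasDerivAt ρ (f t) t)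
    {hS : IsSemialgebraic ℚ (line (Icc a b))}
    {hf : IsSemialgebraicFunOn ℚ (line (Icc a b)) (fun x => f (x 0))}
    {hi : IntegrableOn f (Icc a b)} {hα : IsAlgebraic ℚ (ρ b - ρ a)} :
    of (lineRep (Icc a b) f hS hf hi) - of (constCell (ρ b - ρ a) hα) ∈ relations := by
  set r := lineRep (Icc a b) f hS hf hi with hr
  set r' := constCell (ρ b - ρ a) hα with hr'
  set F : (Fin (0 + 1) → ℝ) → ℝ := fun z => ρ (z 0) with hF
  have snoc_apply_zero : ∀ (x : Fin 0 → ℝ) (t : ℝ), (Fin.snoc x t : Fin 1 → ℝ) 0 = t :=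
    fun x t => Fin.snoc_last (α := fun _ => ℝ) (p := x) (x := t)
  have hFsa : IsSemialgebraicFunOn ℚ r.domain F := hρ
  have hasa : IsSemialgebraicFunOn ℚ r'.domain fun _ => a :=
    isSemialgebraicFunOn_const_of_isAlgebraic isSemialgebraic_univ ha
  have hbsa : IsSemialgebraicFunOn ℚ r'.domain fun _ => b :=
    isSemialgebraicFunOn_const_of_isAlgebraic isSemialgebraic_univ hb
  have hab' : ∀ x ∈ r'.domain, (fun _ => a) x ≤ (fun _ => b) x := fun _ _ => hab
  have hdom : r.domain = {z | (Fin.init z : Fin 0 → ℝ) ∈ r'.domain ∧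
      (fun _ => a) (Fin.init z) ≤ z (Fin.last 0) ∧ z (Fin.last 0) ≤ (fun _ => b) (Fin.init z)} := by
    ext z
    simp [hr, hr', line]
  have hcont' : ∀ x ∈ r'.domain, ContinuousOn (fun t : ℝ => F (Fin.snoc x t))
      (Icc ((fun _ => a) x) ((fun _ => b) x)) := by
    intro x _
    simpa only [hF, snoc_apply_zero] using hcont
  have hder' : ∀ x ∈ r'.domain, ∀ t ∈ Ioo ((fun _ => a) x) ((fun _ => b) x),
      HasDerivAt (fun s : ℝ => F (Fin.snoc x s)) (r.integrand (Fin.snoc x t)) t := by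
    intro x _ t ht
    simpa only [hF, hr, lineRep_integrand, snoc_apply_zero] using hder t ht
  have hval : ∀ x ∈ r'.domain, r'.integrand x =
      F (Fin.snoc x ((fun _ => b) x)) - F (Fin.snoc x ((fun _ => a) x)) := by
    intro x _
    simp only [hr', constCell_integrand, hF, snoc_apply_zero]
  exact newtonLeibnizRel_subset_relations ⟨0, r, r', fun _ => a, fun _ => b, F, hFsa, hasa, hbsa,
    hab', hdom, hcont', hder', hval, rfl⟩

end SoloBlind

end Summit.KontsevichZagierPeriods.KontsevichZagierPeriods.Theorems
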